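import Mathlib
import Summits.KontsevichZagierPeriods.KontsevichZagierPeriods.Theorems.InverseLandauTateFamilyKernelRationalCertificate
import Summits.KontsevichZagierPeriods.KontsevichZagierPeriods.Theorems.InverseLandauTateFamilyKernelStubAssembly

/-!
# Crux `TateFamilyKernel` (stmt-KontsevichZagierPeriods-9130), line `Sketch` — stub `stub_exactDescent`

The inductive heart of the EXACT part in the lead's skeleton of the crux
`Summit.KontsevichZagierPeriods.KontsevichZagierPeriods.Theses.InverseLandau.TateFamilyKernel`
(route `InverseLandau`): given the tame-fibre crux one dimension down (hypothesis `IH`), Griffiths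
data `G_k = A_k/D_k(·, ϖ₀)` regular on the closed cube `[0,1]^{N+2}` at a real-algebraic `ϖ₀`, and an
admissible Tate family `P_b/Q_b` in `N + 1` cube variables with vanishing open-cube integrals whose
fibre at `ϖ₀` is the summed face differences `Σ_k (G_k|_{i_k = 1} − G_k|_{i_k = 0})`, every tame cube
representation of the exact form `Σ_k ∂_{i_k} G_k` is a relation:

  `Σ_k ∂_{i_k} G_k = Σ_k relA_{i_k}(G_k) + Σ_k (E_k ∘ removeNth i_k − E_k ∘ removeNth last) + u ∘ removeNth last`,

`E_k = G_k|₁ − G_k|₀`, `u = Σ_k E_k = P_b/Q_b(·, ϖ₀)` on the cube. The Ayoub elements are relations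
(`tame_sum_relA_mem_relations_dim`); each middle term is a kind-(d) element `h − h ∘ (· ∘ e)` for the
coordinate permutation `e = KZ.RFun.toLast i_k` (`tame_sub_comp_equiv_mem_relations`); the last term
is the lift of `u` (`tame_liftAt`), a relation by `IH`; linearity (`tame_add_sum_mem_relations`)
assembles. No named fact, no new definition.
References: Kontsevich–Zagier 2001 §1.2 rules (1)–(3); Ayoub, EMS Newsl. 91 (2014), Def. 10.
-/

noncomputable section

open MeasureTheory Set MvPolynomial
open Literature.NumberTheory.Transcendental
open Literature.ModelTheory.ExponentialFields (IsSemialgebraic)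

namespace Summit.KontsevichZagierPeriods.InverseLandau.TateFamilyKernel.Descent

/-- Removing coordinate `j` after relabelling by `toLast j` is removing the last coordinate:
`removeNth j (x ∘ toLast j) = removeNth last x` (since `toLast j (j.succAbove t) = castSucc t`).
[folklore] -/
theorem removeNth_comp_toLast {M : ℕ} (j : Fin (M + 1)) (x : Fin (M + 1) → ℝ) :
    Fin.removeNth j (fun t => x (KZ.RFun.toLast j t)) = Fin.removeNth (Fin.last M) x := by
  funext t
  simp [Fin.removeNth, KZ.RFun.toLast_succAbove]

/-- **Kind (d) for a transported face function.** For tame `E` on `[0,1]^M` and a coordinate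
`j`, every tame cube representation of `w ↦ E (removeNth j w) − E (removeNth last w)` on
`[0,1]^{M+1}` is a relation: with `h = E ∘ removeNth j` this is `h − h ∘ (· ∘ toLast j)`, one
change of variables (`tame_sub_comp_equiv_mem_relations`). [cite: KontsevichZagier2001, §1.2] -/
theorem tame_removeNth_sub_removeNth_last_mem_relations {M : ℕ} (j : Fin (M + 1))
    {E : (Fin M → ℝ) → ℝ} (hEa : AnalyticOnNhd ℝ E (KZ.cube M))
    (hEs : IsSemialgebraicFunOn ℚ (KZ.cube M) E)
    (T : KZ.IntegralRep (M + 1)) (hT : T.IsTameCube)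
    (hTi : ∀ w ∈ KZ.cube (M + 1), T.integrand w =
      E (Fin.removeNth j w) - E (Fin.removeNth (Fin.last M) w)) :
    KZ.of T ∈ KZ.relations :=
  tame_sub_comp_equiv_mem_relations (KZ.RFun.toLast j) (h := fun w => E (Fin.removeNth j w))
    (analyticOnNhd_comp_removeNth hEa j) (isSemialgebraicFunOn_comp_removeNth hEs j) T hT
    fun w hw => by rw [hTi w hw, removeNth_comp_toLast]

/-- **The lift of a relation is a relation.** If `u` is tame on `[0,1]^M` and every tame cube
representation of `u` is a relation, then every tame cube representation of
`w ↦ u (removeNth last w)` on `[0,1]^{M+1}` is a relation (`tame_liftAt` along the last coordinate,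
then the hypothesis for `[[0,1]^M, u]`). [cite: KontsevichZagier2001, §1.2] -/
theorem tame_lift_last_mem_relations {M : ℕ} {u : (Fin M → ℝ) → ℝ}
    (hua : AnalyticOnNhd ℝ u (KZ.cube M)) (hus : IsSemialgebraicFunOn ℚ (KZ.cube M) u)
    (hu : ∀ Φ : KZ.IntegralRep M, Φ.IsTameCube → (∀ x ∈ KZ.cube M, Φ.integrand x = u x) →
      KZ.of Φ ∈ KZ.relations)
    (T : KZ.IntegralRep (M + 1)) (hT : T.IsTameCube)
    (hTi : ∀ w ∈ KZ.cube (M + 1), T.integrand w = u (Fin.removeNth (Fin.last M) w)) :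
    KZ.of T ∈ KZ.relations := by
  set u0 : KZ.IntegralRep M := KZ.IntegralRep.tameCube u hua hus with hu0
  have h1 : KZ.of T - KZ.of u0 ∈ KZ.relations :=
    tame_liftAt (Fin.last M) hua hus T hT hTi u0 (KZ.IntegralRep.isTameCube_tameCube _ _ _)
      fun x _ => by simp [hu0]
  have h2 : KZ.of u0 ∈ KZ.relations :=
    hu u0 (KZ.IntegralRep.isTameCube_tameCube _ _ _) fun x _ => by simp [hu0]
  have : KZ.of T = (KZ.of T - KZ.of u0) + KZ.of u0 := by abel
  rw [this]
  exact KZ.relations.add_mem h1 h2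

/-- **Exact descent, abstract form.** Tame data `G_k, G'_k` on `[0,1]^{N+2}` with
`∂_{i_k} G_k = G'_k` on the cube, and a tame `u` on `[0,1]^{N+1}` all of whose tame cube
representations are relations and which equals on the cube the summed face differences
`Σ_k (G_k(insertNth i_k 1 x) − G_k(insertNth i_k 0 x))`: then every tame cube representation of
`Σ_k G'_k` is a relation. Decomposition
`Σ_k G'_k = Σ_k relA_{i_k}(G_k) + (u ∘ removeNth last + Σ_k (E_k ∘ removeNth i_k − E_k ∘ removeNth last))`
with `E_k = G_k|₁ − G_k|₀`, assembled by `tame_add_sum_mem_relations`.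
[cite: Ayoub2014, Def. 10] [cite: KontsevichZagier2001, §1.2] -/
theorem tame_exactDescent {N K : ℕ} (i : Fin K → Fin (N + 2))
    {G G' : Fin K → (Fin (N + 2) → ℝ) → ℝ}
    (hGa : ∀ k, AnalyticOnNhd ℝ (G k) (KZ.cube (N + 2)))
    (hGs : ∀ k, IsSemialgebraicFunOn ℚ (KZ.cube (N + 2)) (G k))
    (hG'a : ∀ k, AnalyticOnNhd ℝ (G' k) (KZ.cube (N + 2)))
    (hG's : ∀ k, IsSemialgebraicFunOn ℚ (KZ.cube (N + 2)) (G' k))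
    (hder : ∀ k, ∀ w ∈ KZ.cube (N + 2),
      HasDerivAt (fun t : ℝ => G k (Function.update w (i k) t)) (G' k w) (w (i k)))
    {u : (Fin (N + 1) → ℝ) → ℝ} (hua : AnalyticOnNhd ℝ u (KZ.cube (N + 1)))
    (hus : IsSemialgebraicFunOn ℚ (KZ.cube (N + 1)) u)
    (hu : ∀ Φ : KZ.IntegralRep (N + 1), Φ.IsTameCube → (∀ x ∈ KZ.cube (N + 1), Φ.integrand x = u x) →
      KZ.of Φ ∈ KZ.relations)
    (hval : ∀ x ∈ KZ.cube (N + 1),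
      u x = ∑ k, (G k (Fin.insertNth (i k) 1 x) - G k (Fin.insertNth (i k) 0 x)))
    (R : KZ.IntegralRep (N + 2)) (hR : R.IsTameCube)
    (hRi : ∀ w ∈ KZ.cube (N + 2), R.integrand w = ∑ k, G' k w) :
    KZ.of R ∈ KZ.relations := by
  have h1c : ((1 : ℚ) : ℝ) ∈ Icc (0 : ℝ) 1 := by norm_num
  have h0c : ((0 : ℚ) : ℝ) ∈ Icc (0 : ℝ) 1 := by norm_num
  -- the face differences `E k` on `[0,1]^{N+1}`
  set E : Fin K → (Fin (N + 1) → ℝ) → ℝ := fun k x =>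
    G k (Fin.insertNth (i k) 1 x) - G k (Fin.insertNth (i k) 0 x) with hE
  have hEa : ∀ k, AnalyticOnNhd ℝ (E k) (KZ.cube (N + 1)) := fun k x hx =>
    (analyticOnNhd_comp_insertNth (hGa k) (i k) (c := 1) ⟨zero_le_one, le_rfl⟩ x hx).sub
      (analyticOnNhd_comp_insertNth (hGa k) (i k) (c := 0) ⟨le_rfl, zero_le_one⟩ x hx)
  have hEs : ∀ k, IsSemialgebraicFunOn ℚ (KZ.cube (N + 1)) (E k) := fun k => by
    have h1 := isSemialgebraicFunOn_comp_insertNth (hGs k) (i k) (c := 1) h1c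
    have h0 := isSemialgebraicFunOn_comp_insertNth (hGs k) (i k) (c := 0) h0c
    simp only [Rat.cast_one, Rat.cast_zero] at h1 h0
    exact IsSemialgebraicFunOn.sub_holds h1 h0
  -- the extra terms: the lift of `u` (index `none`) and the transports (indices `some k`)
  set H : Option (Fin K) → (Fin (N + 2) → ℝ) → ℝ := fun l w =>
    Option.elim l (u (Fin.removeNth (Fin.last (N + 1)) w))
      (fun k => E k (Fin.removeNth (i k) w) - E k (Fin.removeNth (Fin.last (N + 1)) w)) with hH
  refine tame_add_sum_mem_relations (Finset.univ : Finset (Option (Fin K)))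
    (g := fun w => ∑ k, (G' k w - G k (Function.update w (i k) 1) + G k (Function.update w (i k) 0)))
    (fun S hS hSi => tame_sum_relA_mem_relations_dim Finset.univ i (fun k _ => hGa k)
      (fun k _ => hGs k) (fun k _ => hG'a k) (fun k _ => hG's k) (fun k _ => hder k) S hS hSi)
    (H := H) ?_ ?_ ?_ R hR ?_
  · rintro (_ | k) -
    · exact analyticOnNhd_comp_removeNth hua (Fin.last (N + 1))
    · exact fun w hw => (analyticOnNhd_comp_removeNth (hEa k) (i k) w hw).sub
        (analyticOnNhd_comp_removeNth (hEa k) (Fin.last (N + 1)) w hw)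
  · rintro (_ | k) -
    · exact isSemialgebraicFunOn_comp_removeNth hus (Fin.last (N + 1))
    · exact IsSemialgebraicFunOn.sub_holds (isSemialgebraicFunOn_comp_removeNth (hEs k) (i k))
        (isSemialgebraicFunOn_comp_removeNth (hEs k) (Fin.last (N + 1)))
  · rintro (_ | k) - T hT hTi
    · exact tame_lift_last_mem_relations hua hus hu T hT hTi
    · exact tame_removeNth_sub_removeNth_last_mem_relations (i k) (hEa k) (hEs k) T hT hTi
  · -- the pointwise identity on the cube
    intro w hw
    have hwu : Fin.removeNth (Fin.last (N + 1)) w ∈ KZ.cube (N + 1) := removeNth_mem_cube _ hw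
    have huw : u (Fin.removeNth (Fin.last (N + 1)) w) = ∑ k, E k (Fin.removeNth (Fin.last (N + 1)) w) :=
      hval _ hwu
    have hface : ∀ k, E k (Fin.removeNth (i k) w) =
        G k (Function.update w (i k) 1) - G k (Function.update w (i k) 0) := fun k => by
      simp only [hE, Fin.insertNth_removeNth]
    rw [hRi w hw, Fintype.sum_option]
    simp only [hH, Option.elim_none, Option.elim_some]
    rw [huw]
    simp only [hface, Finset.sum_add_distrib, Finset.sum_sub_distrib]
    ring

/-- STUB `stub_exactDescent` of the lead's skeleton (the exact part is a relation, given the crux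
one dimension down). With the tame-fibre crux in dimension `N + 1` as hypothesis `IH`, Griffiths
data `A_k/D_k` regular on the closed cube at a real-algebraic `ϖ₀ ∈ (0, ε)`, and an admissible Tate
family `P_b/Q_b` of dimension `N + 1` with vanishing open-cube integrals on `(0, ε)` whose fibre at
`ϖ₀` is the summed face differences of the `A_k/D_k`, every tame cube representation of the exact
form `Σ_k ∂_{i_k}(A_k/D_k)(·, ϖ₀)` is a relation (`tame_exactDescent` with the slices
`G_k = A_k/D_k(·, ϖ₀)`, `G'_k` = quotient rule, `u = P_b/Q_b(·, ϖ₀)`, the latter's tame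
representations being relations by `IH`). [cite: KontsevichZagier2001, §1.2] [cite: Ayoub2014, Def. 10] -/
theorem stub_exactDescent (N : ℕ)
    (IH : ∀ (P Q : MvPolynomial (Fin (N + 1 + 1)) ℚ) (ε : ℝ), 0 < ε →
      (∃ c₀ : ℚ, c₀ ≠ 0 ∧ ∀ z : Fin (N + 1) → ℝ,
        aeval (Fin.snoc z (0 : ℝ) : Fin (N + 1 + 1) → ℝ) Q = (c₀ : ℝ)) →
      (∀ (z : Fin (N + 1) → ℝ) (ϖ : ℝ), (∀ t, z t ∈ Icc (0 : ℝ) 1) → ϖ ∈ Ioo 0 ε →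
        aeval (Fin.snoc z ϖ : Fin (N + 1 + 1) → ℝ) Q ≠ 0) →
      (∀ ϖ ∈ Ioo (0 : ℝ) ε, ∫ z in Set.pi Set.univ (fun _ : Fin (N + 1) => Ioo (0 : ℝ) 1),
        aeval (Fin.snoc z ϖ : Fin (N + 1 + 1) → ℝ) P / aeval (Fin.snoc z ϖ : Fin (N + 1 + 1) → ℝ) Q = 0) →
      ∀ ϖ₀ : ℝ, IsAlgebraic ℚ ϖ₀ → ϖ₀ ∈ Ioo 0 ε →
      ∀ Φ : KZ.IntegralRep (N + 1), Φ.IsTameCube →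
        (∀ z ∈ KZ.cube (N + 1), Φ.integrand z =
          aeval (Fin.snoc z ϖ₀ : Fin (N + 1 + 1) → ℝ) P / aeval (Fin.snoc z ϖ₀ : Fin (N + 1 + 1) → ℝ) Q) →
        KZ.of Φ ∈ KZ.relations)
    (K : ℕ) (i : Fin K → Fin (N + 2)) (A Dn : Fin K → MvPolynomial (Fin (N + 2 + 1)) ℚ)
    (ε : ℝ) (hε : 0 < ε) (ϖ₀ : ℝ) (halg : IsAlgebraic ℚ ϖ₀) (hϖ₀ : ϖ₀ ∈ Ioo 0 ε)
    (hDn : ∀ k, ∀ w ∈ KZ.cube (N + 2), aeval (Fin.snoc w ϖ₀ : Fin (N + 2 + 1) → ℝ) (Dn k) ≠ 0)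
    (Pb Qb : MvPolynomial (Fin (N + 1 + 1)) ℚ)
    (hbT : ∃ c₀ : ℚ, c₀ ≠ 0 ∧ ∀ x : Fin (N + 1) → ℝ,
      aeval (Fin.snoc x (0 : ℝ) : Fin (N + 1 + 1) → ℝ) Qb = (c₀ : ℝ))
    (hbadm : ∀ (x : Fin (N + 1) → ℝ) (ϖ : ℝ), (∀ t, x t ∈ Icc (0 : ℝ) 1) → ϖ ∈ Ioo 0 ε →
      aeval (Fin.snoc x ϖ : Fin (N + 1 + 1) → ℝ) Qb ≠ 0)
    (hbval : ∀ x ∈ KZ.cube (N + 1),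
      aeval (Fin.snoc x ϖ₀ : Fin (N + 1 + 1) → ℝ) Pb / aeval (Fin.snoc x ϖ₀ : Fin (N + 1 + 1) → ℝ) Qb =
        ∑ k, (aeval (Fin.snoc (Fin.insertNth (i k) 1 x) ϖ₀ : Fin (N + 2 + 1) → ℝ) (A k) /
              aeval (Fin.snoc (Fin.insertNth (i k) 1 x) ϖ₀ : Fin (N + 2 + 1) → ℝ) (Dn k) -
            aeval (Fin.snoc (Fin.insertNth (i k) 0 x) ϖ₀ : Fin (N + 2 + 1) → ℝ) (A k) /
              aeval (Fin.snoc (Fin.insertNth (i k) 0 x) ϖ₀ : Fin (N + 2 + 1) → ℝ) (Dn k)))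
    (hbvan : ∀ ϖ ∈ Ioo (0 : ℝ) ε, ∫ x in Set.pi Set.univ (fun _ : Fin (N + 1) => Ioo (0 : ℝ) 1),
      aeval (Fin.snoc x ϖ : Fin (N + 1 + 1) → ℝ) Pb / aeval (Fin.snoc x ϖ : Fin (N + 1 + 1) → ℝ) Qb = 0) :
    ∀ R : KZ.IntegralRep (N + 2), R.IsTameCube →
      (∀ w ∈ KZ.cube (N + 2), R.integrand w =
        ∑ k, aeval (Fin.snoc w ϖ₀ : Fin (N + 2 + 1) → ℝ)
            (pderiv (Fin.castSucc (i k)) (A k) * Dn k - A k * pderiv (Fin.castSucc (i k)) (Dn k)) /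
          aeval (Fin.snoc w ϖ₀ : Fin (N + 2 + 1) → ℝ) (Dn k ^ 2)) →
      KZ.of R ∈ KZ.relations := by
  intro R hR hRi
  -- the boundary family is pole-free on the closed cube at `ϖ₀`
  have hQb : ∀ x ∈ KZ.cube (N + 1), aeval (Fin.snoc x ϖ₀ : Fin (N + 1 + 1) → ℝ) Qb ≠ 0 :=
    fun x hx => hbadm x ϖ₀ (fun t => KZ.mem_cube.1 hx t) hϖ₀
  have hD2 : ∀ k, ∀ w ∈ KZ.cube (N + 2),
      aeval (Fin.snoc w ϖ₀ : Fin (N + 2 + 1) → ℝ) (Dn k ^ 2) ≠ 0 := fun k w hw => by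
    rw [map_pow]; exact pow_ne_zero 2 (hDn k w hw)
  exact tame_exactDescent i
    (G := fun k w => aeval (Fin.snoc w ϖ₀ : Fin (N + 2 + 1) → ℝ) (A k) /
      aeval (Fin.snoc w ϖ₀ : Fin (N + 2 + 1) → ℝ) (Dn k))
    (G' := fun k w => aeval (Fin.snoc w ϖ₀ : Fin (N + 2 + 1) → ℝ)
        (pderiv (Fin.castSucc (i k)) (A k) * Dn k - A k * pderiv (Fin.castSucc (i k)) (Dn k)) /
      aeval (Fin.snoc w ϖ₀ : Fin (N + 2 + 1) → ℝ) (Dn k ^ 2))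
    (fun k => analyticOnNhd_slice (A k) (Dn k) ϖ₀ (hDn k))
    (fun k => isSemialgebraicFunOn_slice (A k) (Dn k) halg (hDn k))
    (fun k => analyticOnNhd_slice _ _ ϖ₀ (hD2 k))
    (fun k => isSemialgebraicFunOn_slice _ _ halg (hD2 k))
    (fun k w hw => hasDerivAt_slice_update (A k) (Dn k) ϖ₀ (i k) w (hDn k w hw))
    (analyticOnNhd_slice Pb Qb ϖ₀ hQb) (isSemialgebraicFunOn_slice Pb Qb halg hQb)
    (fun Φ hΦ hΦi => IH Pb Qb ε hε hbT hbadm hbvan ϖ₀ halg hϖ₀ Φ hΦ hΦi)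
    (fun x hx => hbval x hx) R hR hRi

end Summit.KontsevichZagierPeriods.InverseLandau.TateFamilyKernel.Descent

end
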